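import Mathlib
import Summits.CriticalPhenomena.PercolationContinuityZ3.Theorems.PercNearOneGluingNoHeavyLowerTailSigmaCM
import Summits.CriticalPhenomena.PercolationContinuityZ3.Theorems.PercNearOneGluingNoHeavyLowerTailReciprocalCM
import HarnessLib

/-!
# Quadratic-row kernels, III (neutral grabber, `q_B = 1`): the Euler-type integral `J` and the roots `x₁, x₂`

Support file for the Sahi / Conjecture-P programme of route `PercNearOneGluingNoHeavy`
(`--supports stmt-CriticalPhenomena-4575`, prover prim-l12-p5 gen 44; proof note
`prim-l12-p5/PROOF-QB1-HYPERGEOMETRIC-g44.md` §2–§3 and its discrete form §3.3).  No definitions, no named facts, no sorries.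

Ingredients of the explicit completely monotone annihilator of the three-ray band with a NEUTRAL grabber
(`q_B = 1`) in the mixed regime (Type II), used by `…LowerTailBandTwoNeutralTN`:
* `J_contig` — for `J(s) = ∫_0^Y u^s (Y-u)^α (u+c)^β du` (`Y, c > 0`, `α ≥ 0`, `s > -1`) the contiguity relation
  `(s+α+β+3) J(s+2) = ((s+1)(Y-c) - (α+1)c + (β+1)Y) J(s+1) + (s+1)Yc J(s)` (one integration by parts);
* `J_altSum_pos` — `n ↦ J(n+x)` is STRICTLY completely monotone when `0 < Y ≤ 1`, `x > 0`
  (`D_k J(j+·+x) = ∫ u^{j+x}(1-u)^k (Y-u)^α (u+c)^β > 0`); `J_pos` — `J(s) > 0` for `s > -1`;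
* `prodRatio_altSum_nonneg` — `a_n = ∏_{i≤n} i/(i+x)` (Beta(1,x) moments) is completely monotone for `x > 0`
  (LEMMA P of `…SigmaCM` + LEMMA DB of `…ReciprocalCM`);
* `typeII_roots` — the quadratic `x² - (R₁+R₂-1)x + pR₁R₂/(p+1)`, `R_i = (p+1)/g_i`, has real roots
  `x₁ ≥ x₂ > 0` with `R₁ ≤ x₁` whenever `p > 0`, `g₁ > 0`, `0 < g₂ ≤ 1` (sub-neutrality of the copy above B's ray).
-/

namespace Summit.CriticalPhenomena.PercolationContinuityZ3.Theorems

namespace BandTwoNeutral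

open Finset Real MeasureTheory intervalIntegral MomentRatioTN
open scoped Nat

/-! ### The Euler-type integral `J(s) = ∫_0^Y u^s (Y-u)^α (u+c)^β du` and its contiguity relation -/

/-- Continuity of the weight `(Y-u)^α (u+c)^β` on `[0,Y]` for `α ≥ 0`, `c > 0`. -/
theorem weight_continuousOn (Y c α β : ℝ) (hc : 0 < c) (hα : 0 ≤ α) :
    ContinuousOn (fun u : ℝ => (Y - u) ^ α * (u + c) ^ β) (Set.Icc 0 Y) := by
  refine ContinuousOn.mul ?_ ?_
  · exact ((continuous_const.sub continuous_id).continuousOn).rpow_const (fun u _ => Or.inr hα)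
  · exact ((continuous_id.add continuous_const).continuousOn).rpow_const
      (fun u hu => Or.inl (ne_of_gt (by simp only [Pi.add_apply, id]; linarith [hu.1])))

/-- Integrability of `u^s (Y-u)^α (u+c)^β · q(u)` on `[0,Y]` for `s > -1`, `α ≥ 0`, `c > 0`, `q` continuous. -/
theorem J_integrable (Y c α β s : ℝ) (hY : 0 ≤ Y) (hc : 0 < c) (hα : 0 ≤ α) (hs : -1 < s)
    (q : ℝ → ℝ) (hq : Continuous q) :
    IntervalIntegrable (fun u : ℝ => u ^ s * ((Y - u) ^ α * (u + c) ^ β * q u)) volume 0 Y := by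
  refine (intervalIntegral.intervalIntegrable_rpow' hs).mul_continuousOn ?_
  rw [Set.uIcc_of_le hY]
  exact (weight_continuousOn Y c α β hc hα).mul hq.continuousOn

/-- **Contiguity relation** (integration by parts of `u^{s+1}(Y-u)^{α+1}(u+c)^{β+1}`):
`(s+α+β+3) J(s+2) = ((s+1)(Y-c) - (α+1)c + (β+1)Y) J(s+1) + (s+1) Y c J(s)` for `s > -1`, `α ≥ 0`, `Y, c > 0`. -/
theorem J_contig (Y c α β s : ℝ) (hY : 0 < Y) (hc : 0 < c) (hα : 0 ≤ α) (hs : -1 < s) :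
    (s + α + β + 3) * (∫ u in (0:ℝ)..Y, u ^ (s + 2) * ((Y - u) ^ α * (u + c) ^ β))
      = ((s + 1) * (Y - c) - (α + 1) * c + (β + 1) * Y) * (∫ u in (0:ℝ)..Y, u ^ (s + 1) * ((Y - u) ^ α * (u + c) ^ β))
        + (s + 1) * Y * c * (∫ u in (0:ℝ)..Y, u ^ s * ((Y - u) ^ α * (u + c) ^ β)) := by
  -- the primitive and its derivative on (0, Y)
  set G : ℝ → ℝ := fun u => u ^ (s + 1) * ((Y - u) ^ (α + 1) * (u + c) ^ (β + 1)) with hG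
  set P : ℝ → ℝ := fun u => (s + 1) * Y * c + ((s + 1) * (Y - c) - (α + 1) * c + (β + 1) * Y) * u
    - (s + α + β + 3) * u ^ 2 with hP
  have hderiv : ∀ u ∈ Set.Ioo 0 Y, HasDerivAt G (u ^ s * ((Y - u) ^ α * (u + c) ^ β * P u)) u := by
    intro u hu
    have hu0 : 0 < u := hu.1
    have huY : 0 < Y - u := by linarith [hu.2]
    have huc : 0 < u + c := by linarith
    have h1 : HasDerivAt (fun u : ℝ => u ^ (s + 1)) ((s + 1) * u ^ (s + 1 - 1)) u :=
      Real.hasDerivAt_rpow_const (Or.inl hu0.ne')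
    have h2 : HasDerivAt (fun u : ℝ => (Y - u) ^ (α + 1)) ((-1) * (α + 1) * (Y - u) ^ (α + 1 - 1)) u := by
      have h := ((hasDerivAt_id u).const_sub Y).rpow_const (p := α + 1) (Or.inl huY.ne')
      simpa using h
    have h3 : HasDerivAt (fun u : ℝ => (u + c) ^ (β + 1)) ((1) * (β + 1) * (u + c) ^ (β + 1 - 1)) u := by
      have h := ((hasDerivAt_id u).add_const c).rpow_const (p := β + 1) (Or.inl huc.ne')
      simpa using h
    have h123 := h1.mul (h2.mul h3)
    simp only [add_sub_cancel_right] at h123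
    -- the products `x^{q+1} = x^q * x`
    have e1 : u ^ (s + 1) = u ^ s * u := by
      rw [Real.rpow_add hu0, Real.rpow_one]
    have e2 : (Y - u) ^ (α + 1) = (Y - u) ^ α * (Y - u) := by
      rw [Real.rpow_add huY, Real.rpow_one]
    have e3 : (u + c) ^ (β + 1) = (u + c) ^ β * (u + c) := by
      rw [Real.rpow_add huc, Real.rpow_one]
    have hfun : G = (fun u : ℝ => u ^ (s + 1)) * ((fun u : ℝ => (Y - u) ^ (α + 1)) * fun u : ℝ => (u + c) ^ (β + 1)) := by
      funext v; simp only [hG, Pi.mul_apply]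
    rw [hfun]
    refine h123.congr_deriv ?_
    simp only [Pi.mul_apply]
    rw [e1, e2, e3]
    simp only [hP]
    ring
  have hcont : ContinuousOn G (Set.Icc 0 Y) := by
    refine ContinuousOn.mul ?_ (ContinuousOn.mul ?_ ?_)
    · exact (Real.continuous_rpow_const (by linarith)).continuousOn
    · exact ((continuous_const.sub continuous_id).continuousOn).rpow_const (fun u _ => Or.inr (by linarith))
    · exact ((continuous_id.add continuous_const).continuousOn).rpow_const
        (fun u hu => Or.inl (ne_of_gt (by simp only [Pi.add_apply, id]; linarith [hu.1])))
  have hint : IntervalIntegrable (fun u : ℝ => u ^ s * ((Y - u) ^ α * (u + c) ^ β * P u)) volume 0 Y :=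
    J_integrable Y c α β s hY.le hc hα hs P (by
      simp only [hP]
      fun_prop)
  have hFTC := intervalIntegral.integral_eq_sub_of_hasDerivAt_of_le hY.le hcont hderiv hint
  have hG0 : G 0 = 0 := by
    simp only [hG]
    rw [Real.zero_rpow (by linarith)]
    ring
  have hGY : G Y = 0 := by
    simp only [hG]
    rw [sub_self, Real.zero_rpow (by linarith)]
    ring
  rw [hG0, hGY, sub_self] at hFTC
  -- split the integral of u^s Φ P into the three J's
  have eP : ∀ u ∈ Set.uIcc (0:ℝ) Y, u ^ s * ((Y - u) ^ α * (u + c) ^ β * P u)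
      = (s + 1) * Y * c * (u ^ s * ((Y - u) ^ α * (u + c) ^ β))
        + ((s + 1) * (Y - c) - (α + 1) * c + (β + 1) * Y) * (u ^ (s + 1) * ((Y - u) ^ α * (u + c) ^ β))
        - (s + α + β + 3) * (u ^ (s + 2) * ((Y - u) ^ α * (u + c) ^ β)) := by
    intro u hu
    rw [Set.uIcc_of_le hY.le] at hu
    have hu0 : 0 ≤ u := hu.1
    have e1 : u ^ (s + 1) = u ^ s * u := by
      rw [Real.rpow_add' hu0 (by linarith), Real.rpow_one]
    have e2 : u ^ (s + 2) = u ^ s * u ^ 2 := by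
      rw [show s + 2 = s + (2:ℝ) by ring, Real.rpow_add' hu0 (by linarith)]
      norm_num
    rw [e1, e2, hP]
    ring
  rw [intervalIntegral.integral_congr eP] at hFTC
  have i0 : IntervalIntegrable (fun u : ℝ => u ^ s * ((Y - u) ^ α * (u + c) ^ β)) volume 0 Y := by
    simpa using J_integrable Y c α β s hY.le hc hα hs (fun _ => 1) continuous_const
  have i1 : IntervalIntegrable (fun u : ℝ => u ^ (s + 1) * ((Y - u) ^ α * (u + c) ^ β)) volume 0 Y := by
    simpa using J_integrable Y c α β (s + 1) hY.le hc hα (by linarith) (fun _ => 1) continuous_const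
  have i2 : IntervalIntegrable (fun u : ℝ => u ^ (s + 2) * ((Y - u) ^ α * (u + c) ^ β)) volume 0 Y := by
    simpa using J_integrable Y c α β (s + 2) hY.le hc hα (by linarith) (fun _ => 1) continuous_const
  rw [intervalIntegral.integral_sub ((i0.const_mul _).add (i1.const_mul _)) (i2.const_mul _),
    intervalIntegral.integral_add (i0.const_mul _) (i1.const_mul _),
    intervalIntegral.integral_const_mul, intervalIntegral.integral_const_mul,
    intervalIntegral.integral_const_mul] at hFTC
  linear_combination (-1 : ℝ) * hFTC

/-! ### The moment sequence `n ↦ J(n + x)` is strictly completely monotone (`0 < Y ≤ 1`, `x > 0`) -/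

/-- `Σ_i (-1)^i C(k,i) J(j+i+x) = ∫_0^Y u^{j+x} (1-u)^k (Y-u)^α (u+c)^β du > 0`. -/
theorem J_altSum_pos (Y c α β x : ℝ) (hY0 : 0 < Y) (hY1 : Y ≤ 1) (hc : 0 < c) (hα : 0 ≤ α) (hx : 0 < x)
    (k j : ℕ) :
    0 < ∑ i ∈ range (k + 1), (-1 : ℝ) ^ i * (k.choose i : ℝ) *
      ∫ u in (0:ℝ)..Y, u ^ (((j + i : ℕ) : ℝ) + x) * ((Y - u) ^ α * (u + c) ^ β) := by
  have hint : ∀ i : ℕ, IntervalIntegrable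
      (fun u : ℝ => u ^ (((j + i : ℕ) : ℝ) + x) * ((Y - u) ^ α * (u + c) ^ β)) volume 0 Y := by
    intro i
    simpa using J_integrable Y c α β (((j + i : ℕ) : ℝ) + x) hY0.le hc hα
      (by have : (0:ℝ) ≤ ((j + i : ℕ) : ℝ) := by positivity
          linarith) (fun _ => 1) continuous_const
  have step1 : ∑ i ∈ range (k + 1), (-1 : ℝ) ^ i * (k.choose i : ℝ) *
      (∫ u in (0:ℝ)..Y, u ^ (((j + i : ℕ) : ℝ) + x) * ((Y - u) ^ α * (u + c) ^ β))
      = ∫ u in (0:ℝ)..Y, ∑ i ∈ range (k + 1), (-1 : ℝ) ^ i * (k.choose i : ℝ) *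
          (u ^ (((j + i : ℕ) : ℝ) + x) * ((Y - u) ^ α * (u + c) ^ β)) := by
    rw [intervalIntegral.integral_finsetSum (fun i _ => (hint i).const_mul _)]
    refine sum_congr rfl fun i _ => ?_
    rw [intervalIntegral.integral_const_mul]
  have step2 : ∀ u ∈ Set.uIcc (0:ℝ) Y, ∑ i ∈ range (k + 1), (-1 : ℝ) ^ i * (k.choose i : ℝ) *
          (u ^ (((j + i : ℕ) : ℝ) + x) * ((Y - u) ^ α * (u + c) ^ β))
        = u ^ ((j : ℝ) + x) * (1 - u) ^ k * ((Y - u) ^ α * (u + c) ^ β) := by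
    intro u hu
    rw [Set.uIcc_of_le hY0.le] at hu
    have hu0 : 0 ≤ u := hu.1
    have epow : ∀ i : ℕ, u ^ (((j + i : ℕ) : ℝ) + x) = u ^ ((j : ℝ) + x) * u ^ i := by
      intro i
      rw [show (((j + i : ℕ) : ℝ) + x) = ((j : ℝ) + x) + (i : ℝ) by push_cast; ring,
        Real.rpow_add' hu0 (by positivity), Real.rpow_natCast]
    simp_rw [epow]
    have hbin : (1 - u) ^ k = ∑ i ∈ range (k + 1), (-1 : ℝ) ^ i * (k.choose i : ℝ) * u ^ i := by
      rw [sub_eq_neg_add, add_pow]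
      refine sum_congr rfl fun i _ => ?_
      rw [neg_pow, one_pow, mul_one]
      ring
    rw [hbin, mul_sum, sum_mul]
    refine sum_congr rfl fun i _ => ?_
    ring
  rw [step1, intervalIntegral.integral_congr step2]
  have hcont : ContinuousOn (fun u : ℝ => u ^ ((j : ℝ) + x) * (1 - u) ^ k * ((Y - u) ^ α * (u + c) ^ β))
      (Set.Icc 0 Y) := by
    refine ContinuousOn.mul (ContinuousOn.mul ?_ ?_) (weight_continuousOn Y c α β hc hα)
    · exact (Real.continuous_rpow_const (by positivity)).continuousOn
    · exact (continuous_const.sub continuous_id).continuousOn.pow k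
  refine intervalIntegral.intervalIntegral_pos_of_pos_on
    (hcont.intervalIntegrable_of_Icc hY0.le) (fun u hu => ?_) hY0
  have hu0 : 0 < u := hu.1
  have hu1 : u < 1 := lt_of_lt_of_le hu.2 hY1
  have h1 : 0 < u ^ ((j : ℝ) + x) := Real.rpow_pos_of_pos hu0 _
  have h2 : 0 < (1 - u) ^ k := pow_pos (by linarith) k
  have h3 : 0 < (Y - u) ^ α := Real.rpow_pos_of_pos (by linarith [hu.2]) _
  have h4 : 0 < (u + c) ^ β := Real.rpow_pos_of_pos (by linarith) _
  positivity

/-- `J(x-1) = ∫_0^Y u^{x-1} (Y-u)^α (u+c)^β du > 0` for `x > 0` (an absolutely convergent improper integral). -/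
theorem J_pos (Y c α β s : ℝ) (hY0 : 0 < Y) (hc : 0 < c) (hα : 0 ≤ α) (hs : -1 < s) :
    0 < ∫ u in (0:ℝ)..Y, u ^ s * ((Y - u) ^ α * (u + c) ^ β) := by
  have hint : IntervalIntegrable (fun u : ℝ => u ^ s * ((Y - u) ^ α * (u + c) ^ β)) volume 0 Y := by
    simpa using J_integrable Y c α β s hY0.le hc hα hs (fun _ => 1) continuous_const
  refine intervalIntegral.intervalIntegral_pos_of_pos_on hint (fun u hu => ?_) hY0
  have h1 : 0 < u ^ s := Real.rpow_pos_of_pos hu.1 _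
  have h3 : 0 < (Y - u) ^ α := Real.rpow_pos_of_pos (by linarith [hu.2]) _
  have h4 : 0 < (u + c) ^ β := Real.rpow_pos_of_pos (by linarith [hu.1]) _
  positivity

/-! ### The product sequence `a_n = ∏_{i ≤ n} i/(i+x)` (Beta(1,x) moments) -/

/-- `a_n = ∏_{m<n} (m+1)/(m+1+x)` is completely monotone for `x > 0` (LEMMA P of `…SigmaCM` with
`1 - τ_{m+1} = x/(m+1+x)`, which is completely monotone by LEMMA DB applied to `f(r) = r+1+x`). -/
theorem prodRatio_altSum_nonneg (x : ℝ) (hx : 0 < x) (k j : ℕ) :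
    0 ≤ ∑ i ∈ range (k + 1), (-1 : ℝ) ^ i * (k.choose i : ℝ) *
      ∏ m ∈ range (j + i), (((m : ℝ) + 1) / ((m : ℝ) + 1 + x)) := by
  have hτ : ∀ m : ℕ, 0 < (((m + 1 : ℕ) : ℝ)) / (((m + 1 : ℕ) : ℝ) + x) := by
    intro m; positivity
  have key := MomentRatioTN.altSum_prod_nonneg (fun m : ℕ => (m : ℝ) / ((m : ℝ) + x)) hτ ?_ k j
  · refine le_of_le_of_eq key (sum_congr rfl fun i _ => ?_)
    congr 1
    refine prod_congr rfl fun m _ => ?_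
    push_cast
    rfl
  · -- complete monotonicity of m ↦ 1 - τ_{m+1} = x/(m+1+x) = x · (f m)⁻¹, f m = m+1+x
    intro k' j'
    have hf : ∀ r : ℕ, 0 < ((r : ℝ) + 1 + x) := fun r => by positivity
    have hDB := MomentRatioTN.altSum_inv_nonneg (fun r : ℕ => (r : ℝ) + 1 + x) hf ?_ k' j'
    · have e : ∀ i : ℕ, (1 - (((j' + i + 1 : ℕ) : ℝ)) / (((j' + i + 1 : ℕ) : ℝ) + x))
          = x * (((j' + i : ℕ) : ℝ) + 1 + x)⁻¹ := by
        intro i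
        have h := (hf (j' + i)).ne'
        push_cast at h ⊢
        rw [← div_eq_mul_inv, eq_div_iff h]
        field_simp
        ring
      simp_rw [e]
      have : ∑ i ∈ range (k' + 1), (-1 : ℝ) ^ i * (k'.choose i : ℝ) * (x * (((j' + i : ℕ) : ℝ) + 1 + x)⁻¹)
          = x * ∑ i ∈ range (k' + 1), (-1 : ℝ) ^ i * (k'.choose i : ℝ) * (((j' + i : ℕ) : ℝ) + 1 + x)⁻¹ := by
        rw [mul_sum]; refine sum_congr rfl fun i _ => ?_; ring
      rw [this]
      exact mul_nonneg hx.le hDB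
    · -- the first difference of f is the constant 1: D_0 1 = 1, D_k 1 = 0 (k ≥ 1)
      intro k'' j''
      have e : ∀ i : ℕ, ((((j'' + i + 1 : ℕ) : ℝ) + 1 + x) - (((j'' + i : ℕ) : ℝ) + 1 + x)) = 1 := by
        intro i; push_cast; ring
      simp_rw [e, mul_one]
      rcases Nat.eq_zero_or_pos k'' with h0 | hpos
      · subst h0; simp
      · have h := Int.alternating_sum_range_choose_of_ne (Nat.pos_iff_ne_zero.1 hpos)
        have h' : ((∑ i ∈ range (k'' + 1), ((-1 : ℤ) ^ i * (k''.choose i : ℤ)) : ℤ) : ℝ) = 0 := by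
          rw [h]; simp
        push_cast at h'
        rw [h']

/-- Positivity of the partial products. -/
theorem prodRatio_pos (x : ℝ) (hx : 0 < x) (n : ℕ) :
    0 < ∏ m ∈ range n, (((m : ℝ) + 1) / ((m : ℝ) + 1 + x)) :=
  prod_pos fun m _ => by positivity

/-! ### The two roots `x₁ ≥ x₂ > 0` of `x² - (R₁+R₂-1)x + pR₁R₂/(p+1)` (`R_i = (p+1)/g_i`) -/

/-- For `p > 0`, `0 < g₁ ≤ 1`, `0 < g₂ ≤ 1` the quadratic `χ(x) = x² - (R₁+R₂-1)x + pR₁R₂/(p+1)`, `R_i = (p+1)/g_i`,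
has real roots `x₁ ≥ x₂ > 0` with `R₁ ≤ x₁` (sub-neutrality: `χ(R₁) = R₁(1 - 1/g₂) ≤ 0`).  Stated through
`g₁g₂(x₁+x₂) = (g₁+g₂)(p+1) - g₁g₂` and `g₁g₂x₁x₂ = p(p+1)`. -/
theorem typeII_roots (p g₁ g₂ : ℝ) (hp : 0 < p) (hg₁ : 0 < g₁) (hg₂ : 0 < g₂) (hg₂1 : g₂ ≤ 1) :
    ∃ x₁ x₂ : ℝ, g₁ * g₂ * (x₁ + x₂) = (g₁ + g₂) * (p + 1) - g₁ * g₂ ∧ g₁ * g₂ * (x₁ * x₂) = p * (p + 1)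
      ∧ 0 < x₂ ∧ x₂ ≤ x₁ ∧ (p + 1) / g₁ ≤ x₁ := by
  set R₁ : ℝ := (p + 1) / g₁ with hR₁
  set R₂ : ℝ := (p + 1) / g₂ with hR₂
  have hgR₁ : g₁ * R₁ = p + 1 := by rw [hR₁]; field_simp
  have hgR₂ : g₂ * R₂ = p + 1 := by rw [hR₂]; field_simp
  have hR₁0 : 0 < R₁ := by rw [hR₁]; positivity
  have hR₂1 : 1 < R₂ := by
    rw [hR₂, lt_div_iff₀ hg₂]; linarith
  set S : ℝ := R₁ + R₂ - 1 with hS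
  set Pr : ℝ := p * R₁ * R₂ / (p + 1) with hPr
  have hgPr : g₁ * g₂ * Pr = p * (p + 1) := by
    rw [hPr, hR₁, hR₂]; field_simp
  have hPrpos : 0 < Pr := by rw [hPr]; positivity
  set D : ℝ := S ^ 2 - 4 * Pr with hD
  -- D = (R₁ - R₂ + 1)² + 4 R₁ (R₂/(p+1) - 1) ≥ 0, since R₂/(p+1) = 1/g₂ ≥ 1
  have hDnn : 0 ≤ D := by
    have h1 : R₂ / (p + 1) = 1 / g₂ := by rw [hR₂]; field_simp
    have h2 : 1 ≤ R₂ / (p + 1) := by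
      rw [h1, le_div_iff₀ hg₂]; linarith
    have e : D = (R₁ - R₂ + 1) ^ 2 + 4 * R₁ * (R₂ / (p + 1) - 1) := by
      rw [hD, hS, hPr]; field_simp; ring
    rw [e]
    have h3 : 0 ≤ 4 * R₁ * (R₂ / (p + 1) - 1) := mul_nonneg (by linarith) (by linarith)
    nlinarith [sq_nonneg (R₁ - R₂ + 1)]
  set x₂ : ℝ := (S - Real.sqrt D) / 2 with hx₂
  set x₁ : ℝ := S - x₂ with hx₁
  have hsq : Real.sqrt D * Real.sqrt D = D := Real.mul_self_sqrt hDnn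
  have hV1 : x₁ + x₂ = S := by rw [hx₁]; ring
  have hV2 : x₁ * x₂ = Pr := by
    rw [hx₁, hx₂]
    have : (S - (S - Real.sqrt D) / 2) * ((S - Real.sqrt D) / 2) = (S * S - Real.sqrt D * Real.sqrt D) / 4 := by
      ring
    rw [this, hsq, hD]; ring
  have hx₂lex₁ : x₂ ≤ x₁ := by
    rw [hx₁, hx₂]; have := Real.sqrt_nonneg D; linarith
  have hSpos : 0 < S := by rw [hS]; linarith
  have hx₂pos : 0 < x₂ := by
    by_contra h
    push Not at h
    have hx₁' : S ≤ x₁ := by rw [hx₁]; linarith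
    have : x₁ * x₂ ≤ 0 := mul_nonpos_of_nonneg_of_nonpos (by linarith) h
    linarith
  -- sub-neutrality: χ(R₁) = (R₁ - x₁)(R₁ - x₂) = R₁(1 - 1/g₂) ≤ 0, hence R₁ ≤ x₁
  have hchi : (R₁ - x₁) * (R₁ - x₂) ≤ 0 := by
    have e : (R₁ - x₁) * (R₁ - x₂) = R₁ * R₁ - S * R₁ + Pr := by
      linear_combination (-R₁) * hV1 + hV2
    have e2 : R₁ * R₁ - S * R₁ + Pr = R₁ * (1 - 1 / g₂) := by
      rw [hS, hPr, hR₂]; field_simp; ring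
    rw [e, e2]
    have : 1 - 1 / g₂ ≤ 0 := by
      rw [sub_nonpos, le_div_iff₀ hg₂]; linarith
    exact mul_nonpos_of_nonneg_of_nonpos hR₁0.le this
  have hα : R₁ ≤ x₁ := by
    by_contra h
    push Not at h
    have h1 : 0 < R₁ - x₁ := by linarith
    have h2 : 0 < R₁ - x₂ := by linarith
    have := mul_pos h1 h2
    linarith
  refine ⟨x₁, x₂, ?_, ?_, hx₂pos, hx₂lex₁, hα⟩
  · rw [hV1, hS]; linear_combination g₂ * hgR₁ + g₁ * hgR₂
  · rw [hV2]; exact hgPr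

end BandTwoNeutral

end Summit.CriticalPhenomena.PercolationContinuityZ3.Theorems
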